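import Summits.BirchSwinnertonDyer.BirchSwinnertonDyer.Theorems.ClassRecordThreeEulerHalvesAtThreeCartanTorusCubeCutPSLine
import HarnessLib

/-!
# Crux 23422 line `cartan` v8′, stub (F2a), PRINCIPAL-SERIES half of the torus-cube cut — file PS-3b: stub (P2)
# `P_psSplitNormSharp` REDUCED to the mod-3 line (`hline`, `hsimple`) and `N_D(X_M) ⊄ 3X`

Seat `bsd-stepL-cartan-f2a` g0 (explicit unit, pen g44 AUTOFILL #2 row (3′); `--supports stmt-BirchSwinnertonDyer-23422 --as helper`).
`psSplitNormSharp_of_line`: for `q ≡ 1 (mod 3)`, given the mod-3 line `X_M ⊂ X` (G-stable, `3X ⊆ X_M`, trivial quotient action, proper;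
`X_M/3X` simple) and ONE vector of `X_M` whose mirabolic norm `N_D = Σ_a ρ(diag(a,1))` is not in `3X`, some translate `ρ(g)w_C` has
split norm `m·w_S` with `3^{ord₃(q−1)+1} ∤ m`. Argument: `V = ℤ[G]w_C + 3X` is `G`-stable; `V ∩ X_M` is `X_M` or inside `3X` by simplicity;
the latter would make `w_C` fixed mod `3`, i.e. `w_C ∈ 3X` by `noFixedVectorModThree`, impossible for a generator; so `X_M ⊆ V`, and if every
`N_D(ρ(g)w_C)` were in `3X` then `N_D(V) ⊆ 3X`, contradicting the hypothesis; finally `N_{T_s} = (q−1)·N_D` (file PS-1) converts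
`N_D(ρ(g)w_C) = m′w_S`, `3 ∤ m′` into `3^{v+1} ∤ (q−1)m′`. Also: small arithmetic helpers (`isCoprime_three_of_not_dvd`,
`not_pow_succ_dvd_mul`) and `span_orbit_map_le` (the `ℤ`-span of a `G`-orbit is `G`-stable).
HONEST FRAMING: a conditional reduction on one lattice; S-K1′ is NOT proved, no summit statement, no route item and no registered stub is
proved; BSD is proved for no curve. [folklore]
-/

namespace Summit.BirchSwinnertonDyer.BirchSwinnertonDyer.Theorems.CartanTorusCubeCut.PS

open Summit.BirchSwinnertonDyer.BirchSwinnertonDyer.Theorems.CartanDegree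
open Summit.BirchSwinnertonDyer.BirchSwinnertonDyer.Theorems.CartanTorusCubeCut

set_option linter.dupNamespace false
set_option autoImplicit false

/-! ### Arithmetic helpers -/

/-- `3 ∤ n ⇒ gcd(3, n) = 1`. -/
theorem isCoprime_three_of_not_dvd {n : ℤ} (hn : ¬ (3 : ℤ) ∣ n) : IsCoprime (3 : ℤ) n :=
  (Int.prime_three.coprime_iff_not_dvd).2 hn

/-- `3^{v+1} ∤ N·m′` when `3^{v+1} ∤ N` … in the form used here: `v = ord₃ N`, `N ≠ 0`, `3 ∤ m′`. -/
theorem not_pow_succ_dvd_mul {N : ℕ} (hN : N ≠ 0) {m' : ℤ} (hm' : ¬ (3 : ℤ) ∣ m') :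
    ¬ (3 : ℤ) ^ (padicValNat 3 N + 1) ∣ (N : ℤ) * m' := by
  intro h
  have hcop : IsCoprime ((3 : ℤ) ^ (padicValNat 3 N + 1)) m' := (isCoprime_three_of_not_dvd hm').pow_left
  have h' : (3 : ℤ) ^ (padicValNat 3 N + 1) ∣ (N : ℤ) := hcop.dvd_of_dvd_mul_right h
  have h'' : 3 ^ (padicValNat 3 N + 1) ∣ N := by exact_mod_cast h'
  haveI : Fact (Nat.Prime 3) := ⟨Nat.prime_three⟩
  exact pow_succ_padicValNat_not_dvd hN h''

variable {q : ℕ} [Fact q.Prime]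

/-! ### The orbit span `ℤ[G]·w` -/

section Orbit
variable (𝓛 : CartanTorusLattice q)

omit [Fact q.Prime] in
/-- the `ℤ`-span of the `G`-orbit of `w` is `G`-stable. -/
theorem span_orbit_map_le (w : Fin 𝓛.d → ℤ) (h : G q) :
    (Submodule.span ℤ (Set.range fun g : G q => 𝓛.ρ g w)).map (𝓛.ρ h) ≤
      Submodule.span ℤ (Set.range fun g : G q => 𝓛.ρ g w) := by
  rw [Submodule.map_span_le]
  rintro _ ⟨g, rfl⟩
  refine Submodule.subset_span ⟨h * g, ?_⟩
  simp [map_mul]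

omit [Fact q.Prime] in
/-- pointwise form. -/
theorem rho_mem_span_orbit (w : Fin 𝓛.d → ℤ) (h : G q) {x : Fin 𝓛.d → ℤ}
    (hx : x ∈ Submodule.span ℤ (Set.range fun g : G q => 𝓛.ρ g w)) :
    𝓛.ρ h x ∈ Submodule.span ℤ (Set.range fun g : G q => 𝓛.ρ g w) :=
  span_orbit_map_le 𝓛 w h ⟨x, hx, rfl⟩

omit [Fact q.Prime] in
/-- `w` lies in the span of its orbit. -/
theorem self_mem_span_orbit (w : Fin 𝓛.d → ℤ) :
    w ∈ Submodule.span ℤ (Set.range fun g : G q => 𝓛.ρ g w) :=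
  Submodule.subset_span ⟨1, by simp⟩

omit [Fact q.Prime] in
/-- a generator of a saturated rank-one fixed lattice is not divisible by `3`: if `w_C = 3w` then `w` is fixed, `w = m w_C`, absurd. -/
theorem wC_not_three_smul {wC : Fin 𝓛.d → ℤ} (hwC : wC ≠ 0)
    (hCgen : ∀ v, 𝓛.IsNonsplitFixed v → ∃ m : ℤ, v = m • wC) (hC : 𝓛.IsNonsplitFixed wC) :
    ¬ ∃ w, wC = (3 : ℤ) • w := by
  rintro ⟨w, hw⟩
  have hwfix : 𝓛.IsNonsplitFixed w := by
    intro t ht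
    have := hC t ht
    rw [hw, map_zsmul] at this
    exact smul_right_injective _ (by norm_num : (3 : ℤ) ≠ 0) this
  obtain ⟨m, hm⟩ := hCgen w hwfix
  rw [hm, smul_smul] at hw
  have : (1 - 3 * m) • wC = 0 := by rw [sub_smul, one_smul, ← hw, sub_self]
  rcases smul_eq_zero.1 this with h | h
  · omega
  · exact hwC h

end Orbit

/-! ### (P2) from the line -/

/-- **(P2) for the given lattice, from the mod-3 line**, simplicity of `X_M/3X`, and `N_D(X_M) ⊄ 3X`. -/
theorem psSplitNormSharp_of_line (𝓛 : CartanTorusLattice q) (h1 : q % 3 = 1)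
    {XM : Submodule ℤ (Fin 𝓛.d → ℤ)}
    (hline : (∀ g : G q, ∀ x ∈ XM, 𝓛.ρ g x ∈ XM) ∧ (∀ x, (3 : ℤ) • x ∈ XM) ∧
      (∀ (g : G q) (x : Fin 𝓛.d → ℤ), 𝓛.ρ g x - x ∈ XM) ∧ XM ≠ ⊤)
    (hsimple : ∀ L : Submodule ℤ (Fin 𝓛.d → ℤ), (∀ g : G q, ∀ x ∈ L, 𝓛.ρ g x ∈ L) →
      (∀ x, (3 : ℤ) • x ∈ L) → L ≤ XM → (L = XM ∨ ∀ x ∈ L, ∃ y, x = (3 : ℤ) • y))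
    (hND : ∃ x ∈ XM, ¬ ∃ y, (∑ a : (ZMod q)ˣ, 𝓛.ρ (diagGL ![a, 1]) x) = (3 : ℤ) • y)
    {wS wC : Fin 𝓛.d → ℤ}
    (hSgen : ∀ v, 𝓛.IsSplitFixed v → ∃ m : ℤ, v = m • wS)
    (hC : 𝓛.IsNonsplitFixed wC) (hCgen : ∀ v, 𝓛.IsNonsplitFixed v → ∃ m : ℤ, v = m • wC) :
    ∃ g : G q, ∀ m : ℤ, normOp 𝓛 (splitTorus q) (𝓛.ρ g wC) = m • wS →
      ¬ (3 : ℤ) ^ (padicValNat 3 (q - 1) + 1) ∣ m := by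
  classical
  obtain ⟨hG, h3, htriv, -⟩ := hline
  have hq : q.Prime := Fact.out
  have hwS : wS ≠ 0 := wS_ne_zero 𝓛 h1 hSgen
  have hwC : wC ≠ 0 := wC_ne_zero 𝓛 h1 hCgen
  -- KEY: some translate has mirabolic norm outside `3X`
  have key : ∃ g : G q, ¬ ∃ y, (∑ a : (ZMod q)ˣ, 𝓛.ρ (diagGL ![a, 1]) (𝓛.ρ g wC)) = (3 : ℤ) • y := by
    by_contra hall
    push Not at hall
    -- `V = ℤ[G]w_C + 3X`
    set A : Submodule ℤ (Fin 𝓛.d → ℤ) := Submodule.span ℤ (Set.range fun g : G q => 𝓛.ρ g wC) with hA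
    set T : Submodule ℤ (Fin 𝓛.d → ℤ) := LinearMap.range (LinearMap.lsmul ℤ (Fin 𝓛.d → ℤ) 3) with hT
    have memT : ∀ x : Fin 𝓛.d → ℤ, x ∈ T ↔ ∃ y, x = (3 : ℤ) • y := by
      intro x
      simp only [hT, LinearMap.mem_range, LinearMap.lsmul_apply]
      exact ⟨fun ⟨y, hy⟩ => ⟨y, hy.symm⟩, fun ⟨y, hy⟩ => ⟨y, hy.symm⟩⟩
    set V := A ⊔ T with hV
    have hV3 : ∀ x, (3 : ℤ) • x ∈ V := fun x => Submodule.mem_sup_right ((memT _).2 ⟨x, rfl⟩)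
    have hVG : ∀ h : G q, ∀ x ∈ V, 𝓛.ρ h x ∈ V := by
      intro h x hx
      rw [hV, Submodule.mem_sup] at hx
      obtain ⟨a, ha, t, ht, rfl⟩ := hx
      rw [map_add]
      refine Submodule.add_mem _ (Submodule.mem_sup_left (rho_mem_span_orbit 𝓛 wC h ha)) ?_
      obtain ⟨y, rfl⟩ := (memT t).1 ht
      rw [map_zsmul]
      exact hV3 _
    have hwCV : wC ∈ V := Submodule.mem_sup_left (self_mem_span_orbit 𝓛 wC)
    -- `N_D` maps `V` into `3X`
    have hNDV : ∀ x ∈ V, ∃ y, (∑ a : (ZMod q)ˣ, 𝓛.ρ (diagGL ![a, 1]) x) = (3 : ℤ) • y := by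
      intro x hx
      rw [← LinearMap.sum_apply]
      have hle : V ≤ T.comap (∑ a : (ZMod q)ˣ, 𝓛.ρ (diagGL ![a, 1])) := by
        rw [hV, sup_le_iff]
        constructor
        · rw [hA, Submodule.span_le]
          rintro _ ⟨g, rfl⟩
          rw [SetLike.mem_coe, Submodule.mem_comap, memT, LinearMap.sum_apply]
          exact hall g
        · intro t ht
          obtain ⟨y, rfl⟩ := (memT t).1 ht
          rw [Submodule.mem_comap, map_zsmul, memT]
          exact ⟨_, rfl⟩
      exact (memT _).1 (hle hx)
    -- `L = V ∩ X_M`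
    rcases hsimple (V ⊓ XM) (fun g x hx => ⟨hVG g x hx.1, hG g x hx.2⟩) (fun x => ⟨hV3 x, h3 x⟩)
        inf_le_right with hL | hL
    · -- `X_M ⊆ V`: contradicts `hND`
      obtain ⟨x, hxM, hx⟩ := hND
      have hxV : x ∈ V := by
        have : x ∈ V ⊓ XM := by rw [hL]; exact hxM
        exact this.1
      exact hx (hNDV x hxV)
    · -- `V ∩ X_M ⊆ 3X`: `w_C` is fixed mod 3, hence divisible by 3 — impossible
      have hfix : ∀ g : G q, ∃ w : Fin 𝓛.d → ℤ, 𝓛.ρ g wC - wC = (3 : ℤ) • w := fun g =>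
        hL _ ⟨V.sub_mem (hVG g _ hwCV) hwCV, htriv g wC⟩
      exact wC_not_three_smul 𝓛 hwC hCgen hC (𝓛.noFixedVectorModThree wC hfix)
  obtain ⟨g, hg⟩ := key
  refine ⟨g, fun m hm => ?_⟩
  obtain ⟨m', hm', rfl⟩ := coeff_normOp_splitTorus_eq 𝓛 hwS hSgen (𝓛.ρ g wC) m hm
  have h3m' : ¬ (3 : ℤ) ∣ m' := by
    rintro ⟨k, rfl⟩
    exact hg ⟨k • wS, by rw [hm', smul_smul]⟩
  have hq1 : q - 1 ≠ 0 := by have := hq.two_le; omega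
  exact not_pow_succ_dvd_mul hq1 h3m'

end Summit.BirchSwinnertonDyer.BirchSwinnertonDyer.Theorems.CartanTorusCubeCut.PS
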